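import Summits.ABC.IUTFork.LDHGenuinePerImageSufficiencyWeighted
import Literature.IUT.LogVolume.DifferentOrdGaloisFibre
import HarnessLib

/-!
# The fork at [IUTchIII] Corollary 3.12, L-DH level, READING (P): the Step (ii) different bound with PER-PRIME FLOORS on the
# different exponent (abc-iut cell, crux ThetaPartII = stmt-ABC-19678; row «C:PERIMAGE-DSW-SUFF», part 1 of 2)

Record-only PROOF file (D-0012) of the abc-iut cell (branch-C certificate seat abc-iut-C-cert-1, gen 7). TAKES NO SIDE on
[IUTchIII] Cor. 3.12. Sequel to abc-iut-c312-d1's `LDHGenuinePerImageSufficiencyWeighted` (p482988), whose Step (ii) lower bound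
`log(𝔡^K) ≥ log-diff(λ) + (1/[F_tpd:ℚ])·Σ_{v∈S}(1 − 1/m_v)·log N(v)` reads ONLY ramification-index floors `m_v ≤ e(w∣v)` (the TAME
bound `ord_w 𝔇 ≥ e_w − 1`). At the places where the tree proves that the datum's field `K` is WILDLY ramified — `√−1 ∈ K` over `2`
(abc-iut-W-num-2's `ThetaVolumeDatumAt.ramificationIdx_le_multiplicity_differentIdeal_over_two`, p484518: `ord_u 𝔇_{K/ℤ} ≥ e(u∣2)`),
the W1 poles over `3`, `5` (abc-iut-W-neg-1's `GenuineK.sub_one_le_multiplicity_differentIdeal_placeOf_wild_ratPoint`, p478727: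
`ord_u 𝔇_{K/ℤ} ≥ 2e(u∣p) − 1`) — a sharper input is a FLOOR ON THE DIFFERENT EXPONENT ITSELF. This file states the bound in that
currency (abc-iut-W-num-2's recommendation, STATUS 2026-08-27T01:16:50Z (5)):

* §1 **`ndeg_differentDivisor_ge_sum_floor`** — for ANY number field `K`, any finite set `T` of rational primes and any real
  floors `B_p` with `B_p·e(w∣p) ≤ ord_w(𝔇_{K/ℤ})` for every place `w ∣ p`, `p ∈ T`:  `Σ_{p∈T} B_p·log p ≤ log(𝔡^K)`
  (`= ndeg K (differentDivisor K)`; [IUTchIV] Def. 1.9 (ii)). Proof: `ord_w(𝔇)·log N(w) ≥ B_p·e_w·f_w·log p`, the fundamental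
  identity `Σ_{w∣p} e_w f_w = [K:ℚ]` (abc-iut-S7's `sum_localDeg`), and abc-iut-S2's `sum_differentDivisor_mul_logNorm_le_degF`.
* §2 **`Cor22.ThetaVolumeDatumAt.cor312PerImageOf_of_le_floor`** — at a genuine Θ-volume datum `T` of `(λ, l)` (ANY presented
  point, `λ ∈ U_X`, `d_mod ≤ (l+5)/4`): `κ_l·log q^{∤2l}(λ) ≤ ((l+5)/4 − d_mod)·Σ_{p∈T} B_p·log p + ((l+5)/4)·log π` with floors
  `B_p` valid at `T.K` ⟹ `T.Cor312PerImageOf` (abc-iut-c312-d1's `GenuineContent.cor312PerImageOf_of_le_mul_ndeg`, BY NAME).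
  The tame floors are the special case `B_p = Σ_{v∣p}(1 − 1/m_v)·f(v∣p)e(v∣p)/[F_tpd:ℚ]`; part 2 (`LDHGenuinePerImageSharpWildRat`)
  feeds the wild floors at rational data.

Classical algebraic number theory around the cell's typed objects; nothing here asserts the existence of Θ-data, Cor. 3.12 in
general or in print's reading, or abc; proved-as-typed ≠ in print. [cite: Mochizuki2012, IUTchIII Cor. 3.12 p. 173–174;
IUTchIV Def. 1.9 p. 21, Thm. 1.10 Step (ii) p. 24, Step (v) p. 27–29] [cite: NeukirchANT1999, Ch. I §8 Prop. (8.2), Ch. III §2 Thm. (2.9)]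
[cite: SerreLocalFields1979, Ch. III §6 Prop. 13] [claim: Mochizuki2012, status: disputed] for every IUT quotation. PROOF-ONLY: no
definitions, no new `Prop`.
-/

noncomputable section

open NumberField IsDedekindDomain Ideal Module

/-! ## 1. The different with per-prime floors on the different exponent -/

namespace Literature.IUT.LogVolume

open Literature.NumberTheory.NumberFields

variable (K : Type) [Field K] [NumberField K]

/-- **`Σ_{p∈T} B_p·log p ≤ log(𝔡^K)`** whenever `B_p·e(w∣p) ≤ ord_w(𝔇_{K/ℤ})` for every place `w` of `K` over every `p ∈ T`
(`T` a finite set of rational primes, `B_p ∈ ℝ` arbitrary — e.g. `1 − 1/m` from a ramification floor `m ∣ e(w∣p)` and the tame bound,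
`2 − 1/m` at an Eisenstein-radical place, `1` over `2` when `√−1 ∈ K`). Per prime: `Σ_{w∣p} ord_w(𝔇)·log N(w) ≥ Σ_{w∣p} B_p·e_w f_w·log p
= B_p·[K:ℚ]·log p` (fundamental identity); then sum over `T` inside `deg(𝔡^K_ADiv)` (all local terms `≥ 0`).
[cite: Mochizuki2012, IUTchIV Def. 1.9 (ii) p. 21, Thm. 1.10 Step (ii) p. 24] [cite: NeukirchANT1999, Ch. I §8 Prop. (8.2)]
[claim: Mochizuki2012, status: disputed] -/
theorem ndeg_differentDivisor_ge_sum_floor (T : Finset ℕ) (hT : ∀ p ∈ T, p.Prime) (B : ℕ → ℝ)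
    (hB : ∀ p ∈ T, ∀ w ∈ placesOver K p,
      B p * (w.asIdeal.ramificationIdx ℤ : ℝ) ≤ (multiplicity w.asIdeal (differentIdeal ℤ (𝓞 K)) : ℝ)) :
    ∑ p ∈ T, B p * Real.log p ≤ ndeg K (differentDivisor K) := by
  classical
  have hK : (0 : ℝ) < Module.finrank ℚ K := by exact_mod_cast Module.finrank_pos
  rw [ndeg_apply, le_div_iff₀ hK, Finset.sum_mul]
  refine le_trans (Finset.sum_le_sum fun p hp => ?_) (sum_differentDivisor_mul_logNorm_le_degF K T hT)
  haveI : Fact p.Prime := ⟨hT p hp⟩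
  -- `[K:ℚ] = Σ_{w∣p} e_w f_w`
  have hfi : (Module.finrank ℚ K : ℝ) = ∑ w ∈ placesOver K p, (localDeg K w : ℝ) := by
    rw [← sum_localDeg K p, Nat.cast_sum]
  rw [hfi, Finset.mul_sum]
  refine Finset.sum_le_sum fun w hw => ?_
  -- `p ∈ w`
  have hpw : ((p : ℕ) : 𝓞 K) ∈ w.asIdeal := by
    have h := (mem_placesOver_iff w).mp hw
    have hmem : ((p : ℕ) : ℤ) ∈ w.asIdeal.under ℤ := by
      rw [← h.over]; exact Ideal.mem_span_singleton_self _
    have := Ideal.mem_comap.mp hmem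
    simpa using this
  -- `log N(w) = f_w·log p`, `ord_w(𝔇)` is the finite coefficient of `𝔡^K_ADiv`
  have hN : logNorm K w = (w.asIdeal.inertiaDeg ℤ : ℝ) * Real.log p := by
    rw [logNorm, absNorm_eq_pow_inertiaDeg K p w hpw]
    push_cast
    rw [Real.log_pow]
  rw [differentDivisor, ADivisor.ofIdeal_apply_inr (differentIdeal_ne_bot' K), hN, localDeg]
  push_cast
  have hlogp : 0 ≤ Real.log p := Real.log_nonneg (by exact_mod_cast (hT p hp).one_lt.le)
  have hf : 0 ≤ (w.asIdeal.inertiaDeg ℤ : ℝ) := Nat.cast_nonneg _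
  have hBw := hB p hp w hw
  calc B p * Real.log p * ((w.asIdeal.ramificationIdx ℤ : ℝ) * (w.asIdeal.inertiaDeg ℤ : ℝ))
      = (B p * (w.asIdeal.ramificationIdx ℤ : ℝ)) * ((w.asIdeal.inertiaDeg ℤ : ℝ) * Real.log p) := by ring
    _ ≤ (multiplicity w.asIdeal (differentIdeal ℤ (𝓞 K)) : ℝ) * ((w.asIdeal.inertiaDeg ℤ : ℝ) * Real.log p) :=
        mul_le_mul_of_nonneg_right hBw (mul_nonneg hf hlogp)

end Literature.IUT.LogVolume

/-! ## 2. The sufficiency at a genuine Θ-volume datum, floors form -/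

namespace Literature.IUT.LogVolume.Cor22

open Literature.NumberTheory.DiophantineGeometry.GenEll Summit.ABC.IUTFork Literature.IUT.HodgeTheaters
open Literature.NumberTheory.NumberFields

namespace ThetaVolumeDatumAt

variable {P : NFPoint} {l : ℕ} (T : ThetaVolumeDatumAt P l)

/-- **THE SUFFICIENT HALF OF THE (P)-LINE CRUX AT A DATUM, FLOORS FORM**: `λ ∈ U_X`, `d_mod ≤ (l+5)/4`, `S` a finite set of rational
primes with real floors `B_p` such that `B_p·e(w∣p) ≤ ord_w(𝔇_{K/ℤ})` for every place `w ∣ p ∈ S` of the datum's `K`; if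
`((l+1)/24 − 1/(2l))·log q^{∤2l}(λ) ≤ ((l+5)/4 − d_mod)·Σ_{p∈S} B_p·log p + ((l+5)/4)·log π`
then [IUTchIII] Cor. 3.12 holds IN READING (P) at `T` (abc-iut-c312-d1's `GenuineContent.cor312PerImageOf_of_le_mul_ndeg` + §1;
the closing lines are adapted from `cor312PerImageOf_of_le_weighted`). [cite: Mochizuki2012, IUTchIII Cor. 3.12 p. 173–174]
[cite: Mochizuki2012, IUTchIV Thm. 1.10 Step (ii) p. 24, Step (v) p. 27–29] [claim: Mochizuki2012, status: disputed] -/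
theorem cor312PerImageOf_of_le_floor (hU : P.InU) (hd : (dmod P : ℝ) ≤ ((l : ℝ) + 5) / 4)
    (S : Finset ℕ) (hS : ∀ p ∈ S, p.Prime) (B : ℕ → ℝ)
    (hB : letI := T.instFieldK; letI := T.instNumberFieldK
      ∀ p ∈ S, ∀ w ∈ placesOver T.K p,
        B p * (w.asIdeal.ramificationIdx ℤ : ℝ) ≤ (multiplicity w.asIdeal (differentIdeal ℤ (𝓞 T.K)) : ℝ))
    (h : (((l : ℝ) + 1) / 24 - 1 / (2 * l)) * logQAvoid P {2, l} ≤
      (((l : ℝ) + 5) / 4 - dmod P) * (∑ p ∈ S, B p * Real.log p) + ThetaVolumeInput.archLogTheta l) :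
    T.Cor312PerImageOf := by
  -- adapted from abc-iut-c312-d1's `cor312PerImageOf_of_le_weighted` (LDHGenuinePerImageSufficiencyWeighted.lean)
  letI := T.instFieldF; letI := T.instNumberFieldF; letI := T.instAlgebraF; letI := T.instFieldK
  letI := T.instNumberFieldK; letI := T.instAlgebraK; letI := T.instFieldFbar; letI := T.instAlgebraFbar
  letI := T.instAlgebraKFbar; letI := T.instIsElliptic
  haveI := T.isGalois_fieldOfModuli_K
  have hgap := PointDict.gap_eq T hU
  have hXlN : T.I.X.l = l := T.isVolumeInputOf.l_eq
  have hXl : ((T.I.X.l : ℕ) : ℝ) = (l : ℝ) := by exact_mod_cast hXlN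
  have hls : ((T.I.X.lstar : ℝ) + 3) / 2 = ((l : ℝ) + 5) / 4 := by
    have h2 : T.I.X.l = 2 * T.I.X.lstar + 1 := T.I.X.l_eq
    have h2R : ((T.I.X.l : ℕ) : ℝ) = 2 * (T.I.X.lstar : ℝ) + 1 := by exact_mod_cast h2
    rw [hXl] at h2R
    linarith
  have hdm : (Module.finrank ℚ (fieldOfModuli T.E) : ℝ) = (dmod P : ℝ) := by
    exact_mod_cast PointStepV.finrank_fieldOfModuli_eq_dmod T
  -- the floors bound at the datum
  have hdiff := ndeg_differentDivisor_ge_sum_floor T.K S hS B hB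
  have hc : 0 ≤ ((l : ℝ) + 5) / 4 - (dmod P : ℝ) := by linarith
  have hmono := mul_le_mul_of_nonneg_left hdiff hc
  show T.I.Cor312PerImageOf
  refine GenuineContent.cor312PerImageOf_of_le_mul_ndeg T.I ?_
  rw [hXl, hls, hdm]
  have hg : T.gap = (((l : ℝ) + 1) / 24 - 1 / (2 * l)) * FinDivisor.ndeg (fieldOfModuli T.E) T.I.X.qDivisor := by
    show LgpDivisor.ndegLgp T.I.X.thetaPilot - FinDivisor.ndeg _ T.I.X.qPilot = _
    rw [DHData.ndegLgp_thetaPilot_eq, PilotData.qPilot_eq_smul, map_smul, smul_eq_mul, hXl]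
    ring
  rw [← hg, hgap]
  show _ ≤ _ + ThetaVolumeInput.archLogTheta T.I.X.l
  rw [hXlN]
  linarith

end ThetaVolumeDatumAt

end Literature.IUT.LogVolume.Cor22

end
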